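import Mathlib
import Literature.NumberTheory.Automorphic.RoelckeSelbergBound

/-!
# Truncated Green identities on `SL₂(ℤ)\ℍ`: the energy route for `λ ≤ 0` and the Maass–Selberg relation for equal eigenvalues
(Iwaniec, *Spectral Methods of Automorphic Forms*, GSM 53, Lemma 4.1 & (4.3), §4.1, PDF p. 48;
Theorem 6.14 & (6.34), §6.4, PDF pp. 67–68; Prop. 6.13 proof, PDF p. 67)

Second file of the inline proof of the named fact
`Literature.NumberTheory.Automorphic.Iwaniec2002_modular_smallSpectrum` (`HyperbolicLaplaceSpectrum.lean`:
an `SL₂(ℤ)`-automorphic `C²` solution of `(Δ + λ)v = 0`, `λ < 1/4` real, square-integrable on `𝒟`, is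
constant). Everything here is PROVED from the truncated energy identity `energy_identity_cut` of
`RoelckeSelbergBound.lean` (layer 23c of the `sl2BallCount_asymp` programme),
`μ ∫_𝒟 |u|² ζ_Y dμ = ∫_𝒟 |y∇u|² ζ_Y dμ + ∫ ζ_Y'(y) m₂(y) dy` (`u ∈ C²` automorphic, `Δu = -μu`,
`ζ_Y` the smooth height cut-off, `m₂(y) = ∫₀¹ ū u_y dx`):

1. **The cross term against the mass in the cusp** (§ CrossTerm): if the horocycle mass
   `m(y) = ∫₀¹ |u(x+iy)|² dx` has `m' = 2 Re m₂`, then `Re ∫ ζ_Y' m₂ = -½ ∫_Y^{2Y} ζ_Y'' m`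
   (integration by parts; `ζ_Y'(Y) = ζ_Y'(2Y) = 0`) and `|Re ∫ ζ_Y' m₂| ≤ 2C₂ ∫_Y^{2Y} m(y) y⁻² dy`
   (`|ζ_Y''| ≤ C₂/Y²`).
2. **The energy route for `λ ≤ 0`** (§ Main; Lemma 4.1: "`-Δ` is non-negative"): for `u` as above
   with `∫_1^∞ m(y) y⁻² dy < ∞` (square-integrability in the cusp of `𝒟`), the real part of the
   identity and the monotonicity of the truncated mass/energy in `Y` give: `μ < 0 ⟹ u ≡ 0`
   (`eq_zero_of_eigenvalue_neg`) and `μ = 0 ⟹ u` constant (`exists_const_of_eigenvalue_zero`; the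
   gradient vanishes on the star-shaped `𝒟ᵒ`, § FdGeometry). The two hypotheses on `m` are supplied
   for `L²` Maass forms by `MaassFormZeroMode.lean` in the final assembly.
3. **Polarization of the imaginary part** (§ Polarization): the cross term `X_Y(u) = ∫ ζ_Y' m₂(u)`
   equals `μ M_Y(u) - G_Y(u)` and is therefore REAL for every admissible `u` (automorphic, `C²`,
   `Δu = -μu`); admissible functions with a common real `μ` form a complex vector space stable under
   conjugation, and `m₂(f - cg) = m₂(f) - c̄ C(f,g) - c C(g,f) + |c|² m₂(g)` with the pair moment
   `C(f,g) = ∫₀¹ ḡ f_y dx`; the reality of `X_Y(f + g)` and `X_Y(f + ig)` yields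
   `∫ ζ_Y' C(g, f) = conj ∫ ζ_Y' C(f, g)` (`cutCrossPair_swap`), i.e.
4. **The truncated Maass–Selberg relation for equal eigenvalues**
   (`integral_deriv_heightCut_mul_wronskianMoment`): `∫ ζ_Y'(y) W(g, h)(y) dy = 0`,
   `W(g, h)(y) = ∫₀¹ (g h_y - h g_y)(x+iy) dx`, for admissible `g, h` — Theorem 6.14/(6.34) with
   `λ₁ = λ₂` and Green's formula on the polygon `F(Y)` replaced by the unfolded, smoothly truncated
   identity (no boundary terms on the sides of `𝒟` arise). This is the input that kills the
   zero-th Fourier coefficient of an `L²` eigenfunction with `0 < λ < 1/4` against `E(z, s)`.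

Mathlib: `intervalIntegral.integral_mul_deriv_eq_deriv_mul`, `intervalIntegral_tendsto_integral_Ioi`,
`ge_of_tendsto`, `Measure.eqOn_open_of_ae_eq`, `IsOpen.exists_is_const_of_fderiv_eq_zero`,
`StarConvex.isPathConnected`, `ModularGroup.coe_fdo`/`fd_eq_closure_fdo`, `Real.smoothTransition`,
`integral_conj`, `ContinuousLinearEquiv.comp_fderiv`. Literature: `energy_identity_cut`, `heightCut` & co.,
`crossMoment`, `hMass`, `continuousOn_crossMoment`, `integrableOn_mul_crossMoment`,
`continuousOn_hMass`, `integrableOn_fd_of_eq_zero_high`, `continuousOn_intervalIntegral_pt`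
(`RoelckeSelbergBound.lean`); `hypFDeriv`, `gradNormSq`, `pt`, `continuous_hypFDeriv_apply`,
`deriv_smoothTransition_eq_zero` (`HyperbolicDirichletForm.lean`); `IsC2.conj`, `hypLaplacian_conj`
(`LocalWeylLaw.lean`); `IsC2.sub_const_mul`, `hypLaplacian_sub_const_mul`, `IsC2.continuous`
(`InvariantOperatorEigenfunctions.lean`); `isOpenPosMeasure_volume` (`MaassCuspForms.lean`);
`modular_fd_covers` (`HyperbolicLaplaceSpectrum.lean`). Not here: the zero-th Fourier mode and the
final assembly (`MaassFormZeroMode.lean`, `HyperbolicLaplaceSpectrumProofs.lean`).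

## References
* [Iwaniec2002] H. Iwaniec, *Spectral Methods of Automorphic Forms*, 2nd ed., GSM 53, AMS 2002
  (held copy `book:iwaniec2002-spectral-methods-automorphic-forms`, PDF pages): Lemma 4.1, (4.3), p. 48;
  Prop. 6.13 (proof), p. 67; Thm 6.14, (6.34) and its proof, pp. 67–68.
-/

noncomputable section

namespace Literature.NumberTheory.Automorphic

open Filter _root_.MeasureTheory Real intervalIntegral Set UpperHalfPlane
open scoped _root_.Topology Interval ComplexConjugate Modular MatrixGroups NNReal ENNReal


/-! ### The second derivative of the height cut-off `ζ_Y` -/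

section SecondDerivCut

/-- `ST'' = 0` off `[0, 1]` (there `ST'` vanishes identically on a neighbourhood). [folklore] -/
theorem deriv_deriv_smoothTransition_eq_zero {x : ℝ} (hx : x < 0 ∨ 1 < x) :
    deriv (deriv Real.smoothTransition) x = 0 := by
  rcases hx with hx | hx
  · have h : deriv Real.smoothTransition =ᶠ[𝓝 x] fun _ => 0 := by
      filter_upwards [isOpen_Iio.mem_nhds hx] with v hv
      exact deriv_smoothTransition_eq_zero (Or.inl (le_of_lt hv))
    rw [h.deriv_eq, deriv_const]
  · have h : deriv Real.smoothTransition =ᶠ[𝓝 x] fun _ => 0 := by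
      filter_upwards [isOpen_Ioi.mem_nhds hx] with v hv
      exact deriv_smoothTransition_eq_zero (Or.inr (le_of_lt hv))
    rw [h.deriv_eq, deriv_const]

/-- `ζ_Y'` as a function. [folklore] -/
theorem deriv_heightCut_fun (Y : ℝ) :
    deriv (heightCut Y) = fun y => -(1 / Y) * deriv Real.smoothTransition (2 - y / Y) :=
  funext fun y => deriv_heightCut Y y

/-- `ST'` is `C¹`. [folklore] -/
theorem contDiff_one_deriv_smoothTransition : ContDiff ℝ 1 (deriv Real.smoothTransition) := by
  have h2 : ContDiff ℝ (1 + 1) Real.smoothTransition := Real.smoothTransition.contDiff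
  exact (contDiff_succ_iff_deriv.mp h2).2.2

/-- `ST''` is continuous. [folklore] -/
theorem continuous_deriv2_smoothTransition : Continuous (deriv (deriv Real.smoothTransition)) :=
  contDiff_one_deriv_smoothTransition.continuous_deriv le_rfl

/-- `|ST''| ≤ C₂` on `ℝ` (continuous, vanishing off `[0, 1]`). [folklore] -/
theorem exists_deriv2_smoothTransition_bound :
    ∃ C : ℝ, 0 ≤ C ∧ ∀ x, |deriv (deriv Real.smoothTransition) x| ≤ C := by
  have hc : Continuous (deriv (deriv Real.smoothTransition)) := continuous_deriv2_smoothTransition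
  obtain ⟨C, hC⟩ := (isCompact_Icc (a := (0 : ℝ)) (b := 1)).exists_bound_of_continuousOn hc.continuousOn
  refine ⟨max C 0, le_max_right _ _, fun x => ?_⟩
  by_cases hx : x ∈ Icc (0 : ℝ) 1
  · exact ((Real.norm_eq_abs _).symm.le.trans (hC x hx)).trans (le_max_left _ _)
  · rw [mem_Icc, not_and_or, not_le, not_le] at hx
    rw [deriv_deriv_smoothTransition_eq_zero hx, abs_zero]
    exact le_max_right _ _

/-- `ζ_Y'' (y) = Y⁻² ST''(2 - y/Y)`. [folklore] -/
theorem hasDerivAt_deriv_heightCut (Y y : ℝ) :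
    HasDerivAt (deriv (heightCut Y))
      ((1 / Y) ^ 2 * deriv (deriv Real.smoothTransition) (2 - y / Y)) y := by
  rw [deriv_heightCut_fun]
  have hST2 : DifferentiableAt ℝ (deriv Real.smoothTransition) (2 - y / Y) :=
    (contDiff_one_deriv_smoothTransition.differentiable one_ne_zero) _
  have hinner : HasDerivAt (fun y : ℝ => 2 - y / Y) (-(1 / Y)) y := by
    have := ((hasDerivAt_id y).div_const Y).const_sub 2
    simpa [one_div] using this
  have h := (hST2.hasDerivAt.comp y hinner).const_mul (-(1 / Y))
  exact h.congr_deriv (by ring)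

/-- `ζ_Y'(Y) = 0`. [folklore] -/
theorem deriv_heightCut_self {Y : ℝ} (hY : 0 < Y) : deriv (heightCut Y) Y = 0 := by
  rw [deriv_heightCut, div_self hY.ne', show (2 : ℝ) - 1 = 1 by norm_num,
    deriv_smoothTransition_eq_zero (Or.inr le_rfl), mul_zero]

/-- `ζ_Y'(2Y) = 0`. [folklore] -/
theorem deriv_heightCut_two_mul {Y : ℝ} (hY : 0 < Y) : deriv (heightCut Y) (2 * Y) = 0 := by
  rw [deriv_heightCut, show 2 * Y / Y = 2 by field_simp, show (2 : ℝ) - 2 = 0 by norm_num,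
    deriv_smoothTransition_eq_zero (Or.inl le_rfl), mul_zero]

/-- `ζ_Y'` is continuous. [folklore] -/
theorem continuous_deriv_heightCut (Y : ℝ) : Continuous (deriv (heightCut Y)) :=
  (contDiff_heightCut Y (n := 1)).continuous_deriv le_rfl

/-- `ζ_Y'` vanishes off `[Y, 2Y]`; its topological support lies there. [folklore] -/
theorem tsupport_deriv_heightCut {Y : ℝ} (hY : 0 < Y) :
    tsupport (deriv (heightCut Y)) ⊆ Icc Y (2 * Y) :=
  closure_minimal (fun y hy => by
    by_contra h
    rw [mem_Icc, not_and_or, not_le, not_le] at h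
    exact hy (deriv_heightCut_eq_zero hY h)) isClosed_Icc

/-- `ζ_Y'` has compact support. [folklore] -/
theorem hasCompactSupport_deriv_heightCut {Y : ℝ} (hY : 0 < Y) :
    HasCompactSupport (deriv (heightCut Y)) :=
  isCompact_Icc.of_isClosed_subset (isClosed_tsupport _) (tsupport_deriv_heightCut hY)

end SecondDerivCut

/-! ### The cross term `Re ∫ ζ_Y' m₂` is controlled by the mass in the cusp -/

section CrossTerm

variable {u : ℍ → ℂ}

/-- **The real part of the cross term of the energy identity**: with `m(y) = ∫₀¹ |u|² dx` and
`m' = 2 Re m₂` (`m₂ = ∫₀¹ ū u_y dx`), integration by parts on `[Y, 2Y]` gives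
`Re ∫ ζ_Y' m₂ dy = -½ ∫_Y^{2Y} ζ_Y'' m dy`. [folklore] -/
theorem re_integral_deriv_heightCut_mul_crossMoment (hu : IsC2 u) {Y : ℝ} (hY : 0 < Y)
    (hMd : ∀ y : ℝ, 0 < y → HasDerivAt (hMass u) (2 * (crossMoment u y).re) y) :
    (∫ y in Ioi (0 : ℝ), ((deriv (heightCut Y) y : ℝ) : ℂ) * crossMoment u y).re =
      -(1 / 2) * ∫ y in Y..(2 * Y),
        (1 / Y) ^ 2 * deriv (deriv Real.smoothTransition) (2 - y / Y) * hMass u y := by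
  have hζ'c := continuous_deriv_heightCut Y
  have hζ's := hasCompactSupport_deriv_heightCut hY
  have hζ'ts := tsupport_deriv_heightCut hY
  have hIcc0 : Icc Y (2 * Y) ⊆ Ioi 0 := fun y hy => lt_of_lt_of_le hY hy.1
  have hζ't0 : tsupport (deriv (heightCut Y)) ⊆ Ioi 0 := hζ'ts.trans hIcc0
  have hint : IntegrableOn (fun y => ((deriv (heightCut Y) y : ℝ) : ℂ) * crossMoment u y) (Ioi 0) :=
    integrableOn_mul_crossMoment hu hζ'c hζ's hζ't0
  -- real part inside
  have h1 : (∫ y in Ioi (0 : ℝ), ((deriv (heightCut Y) y : ℝ) : ℂ) * crossMoment u y).re =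
      ∫ y in Ioi (0 : ℝ), deriv (heightCut Y) y * (crossMoment u y).re := by
    rw [← RCLike.re_to_complex, ← integral_re hint]
    refine setIntegral_congr_fun measurableSet_Ioi fun y _ => ?_
    simp only [RCLike.re_to_complex, Complex.re_ofReal_mul]
  rw [h1]
  -- restrict to `[Y, 2Y]`
  have h2 : ∫ y in Ioi (0 : ℝ), deriv (heightCut Y) y * (crossMoment u y).re =
      ∫ y in Y..(2 * Y), deriv (heightCut Y) y * (crossMoment u y).re := by
    rw [intervalIntegral.integral_of_le (by linarith), ← integral_Icc_eq_integral_Ioc]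
    refine setIntegral_eq_of_subset_of_forall_sdiff_eq_zero measurableSet_Ioi hIcc0 fun y hy => ?_
    have : deriv (heightCut Y) y = 0 := image_eq_zero_of_notMem_tsupport fun h => hy.2 (hζ'ts h)
    simp [this]
  rw [h2]
  -- integrate by parts
  have hcm : ContinuousOn (fun y => (crossMoment u y).re) (uIcc Y (2 * Y)) := by
    rw [uIcc_of_le (by linarith)]
    exact (Complex.continuous_re.comp_continuousOn ((continuousOn_crossMoment hu).mono hIcc0))
  have hST2c : Continuous fun y : ℝ =>
      (1 / Y) ^ 2 * deriv (deriv Real.smoothTransition) (2 - y / Y) :=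
    continuous_const.mul (continuous_deriv2_smoothTransition.comp (by fun_prop))
  have hparts := intervalIntegral.integral_mul_deriv_eq_deriv_mul
    (a := Y) (b := 2 * Y) (u := deriv (heightCut Y)) (v := hMass u)
    (u' := fun y => (1 / Y) ^ 2 * deriv (deriv Real.smoothTransition) (2 - y / Y))
    (v' := fun y => 2 * (crossMoment u y).re)
    (fun y _ => hasDerivAt_deriv_heightCut Y y)
    (fun y hy => hMd y (by
      rw [uIcc_of_le (by linarith)] at hy
      exact lt_of_lt_of_le hY hy.1))
    (hST2c.intervalIntegrable _ _)
    ((continuousOn_const.mul hcm).intervalIntegrable)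
  rw [deriv_heightCut_self hY, deriv_heightCut_two_mul hY, zero_mul, zero_mul, sub_self,
    zero_sub] at hparts
  have h3 : ∫ y in Y..(2 * Y), deriv (heightCut Y) y * (crossMoment u y).re =
      (1 / 2) * ∫ y in Y..(2 * Y), deriv (heightCut Y) y * (2 * (crossMoment u y).re) := by
    rw [← intervalIntegral.integral_const_mul]
    congr 1; funext y; ring
  rw [h3, hparts, ← intervalIntegral.integral_neg]
  rw [← intervalIntegral.integral_const_mul, ← intervalIntegral.integral_const_mul]
  congr 1; funext y; ring

/-- **Bound for the cross term**: `|Re ∫ ζ_Y' m₂| ≤ 2 C₂ ∫_Y^{2Y} m(y) y⁻² dy`. [folklore] -/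
theorem abs_re_integral_crossMoment_le (hu : IsC2 u)
    (hMd : ∀ y : ℝ, 0 < y → HasDerivAt (hMass u) (2 * (crossMoment u y).re) y)
    {C₂ : ℝ} (hC₂0 : 0 ≤ C₂) (hC₂ : ∀ x, |deriv (deriv Real.smoothTransition) x| ≤ C₂)
    {Y : ℝ} (hY : 0 < Y) :
    |(∫ y in Ioi (0 : ℝ), ((deriv (heightCut Y) y : ℝ) : ℂ) * crossMoment u y).re| ≤
      2 * C₂ * ∫ y in Y..(2 * Y), hMass u y * (y ^ 2)⁻¹ := by
  rw [re_integral_deriv_heightCut_mul_crossMoment hu hY hMd]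
  have hle : Y ≤ 2 * Y := by linarith
  have hIcc0 : Icc Y (2 * Y) ⊆ Ioi 0 := fun y hy => lt_of_lt_of_le hY hy.1
  have hmc : ContinuousOn (hMass u) (uIcc Y (2 * Y)) := by
    rw [uIcc_of_le hle]; exact (continuousOn_hMass hu).mono hIcc0
  have hwc : ContinuousOn (fun y : ℝ => hMass u y * (y ^ 2)⁻¹) (uIcc Y (2 * Y)) := by
    refine hmc.mul (ContinuousOn.inv₀ (by fun_prop) fun y hy => ?_)
    rw [uIcc_of_le hle] at hy
    have : 0 < y := lt_of_lt_of_le hY hy.1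
    positivity
  -- pointwise: `|ζ''| m ≤ (C₂ / Y²) m ≤ 4 C₂ m y⁻²` on `[Y, 2Y]`
  have hpt : ∀ y ∈ Icc Y (2 * Y),
      |(1 / Y) ^ 2 * deriv (deriv Real.smoothTransition) (2 - y / Y) * hMass u y| ≤
        4 * C₂ * (hMass u y * (y ^ 2)⁻¹) := by
    intro y hy
    have hy0 : 0 < y := lt_of_lt_of_le hY hy.1
    have hm0 : 0 ≤ hMass u y := hMass_nonneg u y
    rw [abs_mul, abs_of_nonneg hm0, abs_mul, abs_of_nonneg (by positivity : (0 : ℝ) ≤ (1 / Y) ^ 2)]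
    have h1 : (1 / Y) ^ 2 * |deriv (deriv Real.smoothTransition) (2 - y / Y)| ≤ (1 / Y) ^ 2 * C₂ :=
      mul_le_mul_of_nonneg_left (hC₂ _) (by positivity)
    have h2 : (1 / Y) ^ 2 ≤ 4 * (y ^ 2)⁻¹ := by
      rw [div_pow, one_pow, ← div_eq_mul_inv, div_le_div_iff₀ (by positivity) (by positivity)]
      nlinarith [hy.1, hy.2, hY]
    calc (1 / Y) ^ 2 * |deriv (deriv Real.smoothTransition) (2 - y / Y)| * hMass u y
        ≤ (1 / Y) ^ 2 * C₂ * hMass u y := mul_le_mul_of_nonneg_right h1 hm0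
      _ ≤ 4 * (y ^ 2)⁻¹ * C₂ * hMass u y := by gcongr
      _ = 4 * C₂ * (hMass u y * (y ^ 2)⁻¹) := by ring
  calc |-(1 / 2) * ∫ y in Y..(2 * Y),
          (1 / Y) ^ 2 * deriv (deriv Real.smoothTransition) (2 - y / Y) * hMass u y|
      = (1 / 2) * |∫ y in Y..(2 * Y),
          (1 / Y) ^ 2 * deriv (deriv Real.smoothTransition) (2 - y / Y) * hMass u y| := by
        rw [abs_mul, abs_neg, abs_of_pos (by norm_num : (0 : ℝ) < 1 / 2)]
    _ ≤ (1 / 2) * ∫ y in Y..(2 * Y),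
          |(1 / Y) ^ 2 * deriv (deriv Real.smoothTransition) (2 - y / Y) * hMass u y| := by
        gcongr
        exact intervalIntegral.abs_integral_le_integral_abs hle
    _ ≤ (1 / 2) * ∫ y in Y..(2 * Y), 4 * C₂ * (hMass u y * (y ^ 2)⁻¹) := by
        gcongr
        refine intervalIntegral.integral_mono_on hle ?_ ?_ fun y hy => hpt y hy
        · refine (ContinuousOn.abs ?_).intervalIntegrable
          have hST2c : Continuous fun y : ℝ =>
              (1 / Y) ^ 2 * deriv (deriv Real.smoothTransition) (2 - y / Y) :=
            continuous_const.mul (continuous_deriv2_smoothTransition.comp (by fun_prop))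
          exact hST2c.continuousOn.mul hmc
        · exact (continuousOn_const.mul hwc).intervalIntegrable
    _ = 2 * C₂ * ∫ y in Y..(2 * Y), hMass u y * (y ^ 2)⁻¹ := by
        rw [intervalIntegral.integral_const_mul]; ring

end CrossTerm

/-! ### Geometry of `𝒟`: from vanishing integrals to vanishing functions -/

section FdGeometry

/-- The image of `𝒟ᵒ` in `ℂ` is star-convex with respect to `2i`. [folklore] -/
theorem starConvex_coe_fdo : StarConvex ℝ (2 * Complex.I : ℂ) ((↑) '' 𝒟ᵒ : Set ℂ) := by
  rw [ModularGroup.coe_fdo]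
  rintro z ⟨hz0, hz1, hz2⟩ a b ha hb hab
  have hz0' : 0 < z.im := hz0
  have hz2' : |z.re| < 1 / 2 := hz2
  have hn : 1 < z.re * z.re + z.im * z.im := by
    have h1 : (1 : ℝ) < ‖z‖ ^ 2 := by nlinarith [norm_nonneg z, hz1]
    rwa [← Complex.normSq_eq_norm_sq, Complex.normSq_apply] at h1
  have hx2 : z.re * z.re < 1 / 4 := by
    have := abs_lt.mp hz2'
    nlinarith
  have hy2 : 1 / 2 < z.im := by nlinarith
  set w : ℂ := a • (2 * Complex.I) + b • z with hw
  have hw_re : w.re = b * z.re := by simp [hw]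
  have hw_im : w.im = 2 * a + b * z.im := by simp [hw]; ring
  refine ⟨?_, ?_, ?_⟩
  · show 0 < w.im
    rw [hw_im]
    rcases ha.lt_or_eq with ha' | rfl
    · nlinarith [mul_nonneg hb hz0'.le]
    · simp only [zero_add] at hab
      subst hab
      simpa using hz0'
  · show 1 < ‖w‖
    have key : 1 < w.re * w.re + w.im * w.im := by
      rw [hw_re, hw_im]
      rcases ha.lt_or_eq with ha' | rfl
      · nlinarith [mul_nonneg (sq_nonneg b) (sub_nonneg.mpr hn.le),
          mul_nonneg (mul_nonneg ha hb) (sub_nonneg.mpr hy2.le), mul_pos ha' ha',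
          mul_nonneg ha hb]
      · simp only [zero_add] at hab
        subst hab
        nlinarith
    rw [← Complex.normSq_apply, Complex.normSq_eq_norm_sq] at key
    nlinarith [norm_nonneg w]
  · show |w.re| < 1 / 2
    rw [hw_re, abs_mul, abs_of_nonneg hb]
    calc b * |z.re| ≤ 1 * |z.re| := by gcongr; linarith
      _ < 1 / 2 := by simpa using hz2'

/-- The image of `𝒟ᵒ` in `ℂ` is preconnected. [folklore] -/
theorem isPreconnected_coe_fdo : IsPreconnected ((↑) '' 𝒟ᵒ : Set ℂ) := by
  have h2I : (2 * Complex.I : ℂ) ∈ ((↑) '' 𝒟ᵒ : Set ℂ) := by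
    rw [ModularGroup.coe_fdo]
    refine ⟨by simp, by simp, by simp⟩
  exact (starConvex_coe_fdo.isPathConnected h2I).isConnected.isPreconnected

/-- The image of `𝒟ᵒ` in `ℂ` is open. [folklore] -/
theorem isOpen_coe_fdo : IsOpen ((↑) '' 𝒟ᵒ : Set ℂ) :=
  isOpenEmbedding_coe.isOpenMap _ ModularGroup.isOpen_fdo

/-- An `SL₂(ℤ)`-automorphic function that is constant on `𝒟` is constant. [folklore] -/
theorem const_of_const_on_fd {u : ℍ → ℂ} {c : ℂ} (hua : ∀ γ ∈ (𝒮ℒ : Subgroup (GL (Fin 2) ℝ)), ∀ z : ℍ, u (γ • z) = u z)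
    (h : ∀ z ∈ 𝒟, u z = c) (z : ℍ) : u z = c := by
  obtain ⟨γ, hγ, hγz⟩ := modular_fd_covers z
  rw [← hua γ hγ z, h _ hγz]

/-- A continuous function vanishing on `𝒟ᵒ` and automorphic under `SL₂(ℤ)` vanishes. [folklore] -/
theorem eq_const_of_eqOn_fdo {u : ℍ → ℂ} {c : ℂ} (huc : Continuous u)
    (hua : ∀ γ ∈ (𝒮ℒ : Subgroup (GL (Fin 2) ℝ)), ∀ z : ℍ, u (γ • z) = u z) (h : ∀ z ∈ 𝒟ᵒ, u z = c) (z : ℍ) : u z = c := by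
  have h2 : Set.EqOn u (fun _ => c) (closure 𝒟ᵒ) :=
    (show Set.EqOn u (fun _ => c) 𝒟ᵒ from h).closure huc continuous_const
  rw [← ModularGroup.fd_eq_closure_fdo] at h2
  exact const_of_const_on_fd hua h2 z

/-- A continuous non-negative weight integrating to zero against `𝒟` vanishes on `𝒟ᵒ`. [folklore] -/
theorem eqOn_fdo_zero_of_setIntegral_fd_eq_zero {g : ℍ → ℝ} (hg : Continuous g)
    (hg0 : ∀ z, 0 ≤ g z) (hgi : IntegrableOn g 𝒟) (h : ∫ z in 𝒟, g z = 0) :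
    ∀ z ∈ 𝒟ᵒ, g z = 0 := by
  haveI := isOpenPosMeasure_volume
  have hae : g =ᵐ[volume.restrict 𝒟] 0 :=
    (setIntegral_eq_zero_iff_of_nonneg_ae (Eventually.of_forall hg0) hgi).mp h
  have hae' : g =ᵐ[volume.restrict 𝒟ᵒ] fun _ => (0 : ℝ) :=
    ae_restrict_of_ae_restrict_of_subset ModularGroup.fdo_subset_fd hae
  exact Measure.eqOn_open_of_ae_eq hae' ModularGroup.isOpen_fdo hg.continuousOn continuousOn_const

/-- If the real Fréchet derivative of `F : ℂ → ℂ` kills `1` and `I`, it is zero. [folklore] -/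
theorem fderiv_eq_zero_of_apply_one_I {F : ℂ → ℂ} {w : ℂ} (h1 : fderiv ℝ F w 1 = 0)
    (hI : fderiv ℝ F w Complex.I = 0) : fderiv ℝ F w = 0 := by
  ext1 v
  have hv : v = (v.re : ℝ) • (1 : ℂ) + (v.im : ℝ) • Complex.I := by simp
  rw [hv, map_add, map_smul, map_smul, h1, hI]; simp

/-- **Vanishing gradient on `𝒟ᵒ` forces constancy** for automorphic `C²` functions. [folklore] -/
theorem exists_const_of_gradNormSq_eq_zero {u : ℍ → ℂ} (hu : IsC2 u)
    (hua : ∀ γ ∈ (𝒮ℒ : Subgroup (GL (Fin 2) ℝ)), ∀ z : ℍ, u (γ • z) = u z) (h : ∀ z ∈ 𝒟ᵒ, gradNormSq u z = 0) :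
    ∃ c : ℂ, ∀ z, u z = c := by
  set F : ℂ → ℂ := u ∘ ofComplex with hF
  have hgrad : ∀ z ∈ 𝒟ᵒ, fderiv ℝ F (z : ℂ) = 0 := by
    intro z hz
    have h0 := h z hz
    unfold gradNormSq hypFDeriv at h0
    have ha : ‖fderiv ℝ (u ∘ ofComplex) (z : ℂ) 1‖ ^ 2 = 0 := by
      nlinarith [sq_nonneg ‖fderiv ℝ (u ∘ ofComplex) (z : ℂ) 1‖,
        sq_nonneg ‖fderiv ℝ (u ∘ ofComplex) (z : ℂ) Complex.I‖]
    have hb : ‖fderiv ℝ (u ∘ ofComplex) (z : ℂ) Complex.I‖ ^ 2 = 0 := by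
      nlinarith [sq_nonneg ‖fderiv ℝ (u ∘ ofComplex) (z : ℂ) 1‖,
        sq_nonneg ‖fderiv ℝ (u ∘ ofComplex) (z : ℂ) Complex.I‖]
    rw [pow_eq_zero_iff two_ne_zero, norm_eq_zero] at ha hb
    exact fderiv_eq_zero_of_apply_one_I ha hb
  have hdiff : DifferentiableOn ℝ F ((↑) '' 𝒟ᵒ : Set ℂ) :=
    (ContDiffOn.differentiableOn hu (by norm_num)).mono (by rintro _ ⟨z, -, rfl⟩; exact z.im_pos)
  have hzero : ((↑) '' 𝒟ᵒ : Set ℂ).EqOn (fderiv ℝ F) 0 := by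
    rintro _ ⟨z, hz, rfl⟩
    exact hgrad z hz
  obtain ⟨c, hc⟩ := isOpen_coe_fdo.exists_is_const_of_fderiv_eq_zero isPreconnected_coe_fdo
    hdiff hzero
  have hc' : ∀ z ∈ 𝒟ᵒ, u z = c := by
    intro z hz
    have := hc (z : ℂ) ⟨z, hz, rfl⟩
    simpa [hF, ofComplex_apply] using this
  exact ⟨c, eq_const_of_eqOn_fdo hu.continuous hua hc'⟩

end FdGeometry

/-! ### `l ≤ 0`: the energy route -/

section Main

variable {u : ℍ → ℂ} {μ : ℝ}

/-- Tails `∫_Y^{2Y} m(y) y⁻² dy → 0` of the convergent integral `∫_1^∞ m(y) y⁻² dy`. [folklore] -/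
theorem tendsto_intervalIntegral_tail {g : ℝ → ℝ} (hg : IntegrableOn g (Ioi 1)) :
    Tendsto (fun Y : ℝ => ∫ y in Y..(2 * Y), g y) atTop (𝓝 0) := by
  set Φ : ℝ → ℝ := fun Y => ∫ y in (1 : ℝ)..Y, g y with hΦ
  have hΦ1 : Tendsto Φ atTop (𝓝 (∫ y in Ioi (1 : ℝ), g y)) :=
    intervalIntegral_tendsto_integral_Ioi 1 hg tendsto_id
  have hΦ2 : Tendsto (fun Y : ℝ => Φ (2 * Y)) atTop (𝓝 (∫ y in Ioi (1 : ℝ), g y)) :=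
    hΦ1.comp (Tendsto.const_mul_atTop (by norm_num) tendsto_id)
  have hsub := hΦ2.sub hΦ1
  rw [sub_self] at hsub
  refine hsub.congr' ?_
  filter_upwards [eventually_ge_atTop (1 : ℝ)] with Y hY
  have hi : ∀ a b : ℝ, 1 ≤ a → 1 ≤ b → IntervalIntegrable g volume a b := fun a b ha hb =>
    intervalIntegrable_iff.mpr (hg.mono_set fun x hx => lt_of_le_of_lt (le_min ha hb) hx.1)
  rw [hΦ]
  simp only
  rw [← intervalIntegral.integral_add_adjacent_intervals (hi 1 Y le_rfl hY) (hi Y (2 * Y) hY (by linarith))]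
  ring

/-- Continuity of the energy density. [folklore] -/
theorem continuous_gradNormSq (hu : IsC2 u) : Continuous fun z => gradNormSq u z :=
  ((continuous_hypFDeriv_apply hu 1).norm.pow 2).add
    ((continuous_hypFDeriv_apply hu Complex.I).norm.pow 2)

/-- The truncated mass is integrable on `𝒟`. [folklore] -/
theorem integrableOn_cutMass (huc : Continuous u) {Y : ℝ} (hY : 0 < Y) :
    IntegrableOn (fun z : ℍ => ‖u z‖ ^ 2 * heightCut Y z.im) 𝒟 := by
  refine integrableOn_fd_of_eq_zero_high (T := 2 * Y)
    ((huc.norm.pow 2).mul ((contDiff_heightCut Y (n := 0)).continuous.comp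
      UpperHalfPlane.continuous_im)) fun z hz => ?_
  rw [heightCut_eq_zero hY hz.le, mul_zero]

/-- The truncated energy is integrable on `𝒟`. [folklore] -/
theorem integrableOn_cutEnergy (hu : IsC2 u) {Y : ℝ} (hY : 0 < Y) :
    IntegrableOn (fun z : ℍ => z.im ^ 2 * gradNormSq u z * heightCut Y z.im) 𝒟 := by
  refine integrableOn_fd_of_eq_zero_high (T := 2 * Y)
    (((UpperHalfPlane.continuous_im.pow 2).mul (continuous_gradNormSq hu)).mul
      ((contDiff_heightCut Y (n := 0)).continuous.comp UpperHalfPlane.continuous_im)) fun z hz => ?_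
  rw [heightCut_eq_zero hY hz.le, mul_zero]

/-- Monotonicity of the truncated mass in the truncation height. [folklore] -/
theorem cutMass_mono (huc : Continuous u) {Y Y' : ℝ} (hY : 0 < Y) (hYY' : Y ≤ Y') :
    ∫ z in 𝒟, ‖u z‖ ^ 2 * heightCut Y z.im ≤ ∫ z in 𝒟, ‖u z‖ ^ 2 * heightCut Y' z.im :=
  setIntegral_mono_on (integrableOn_cutMass huc hY) (integrableOn_cutMass huc (lt_of_lt_of_le hY hYY'))
    ModularGroup.isClosed_fd.measurableSet fun z _ =>
      mul_le_mul_of_nonneg_left (heightCut_mono z.im_pos.le hY hYY') (sq_nonneg _)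

/-- Monotonicity of the truncated energy in the truncation height. [folklore] -/
theorem cutEnergy_mono (hu : IsC2 u) {Y Y' : ℝ} (hY : 0 < Y) (hYY' : Y ≤ Y') :
    ∫ z in 𝒟, z.im ^ 2 * gradNormSq u z * heightCut Y z.im ≤
      ∫ z in 𝒟, z.im ^ 2 * gradNormSq u z * heightCut Y' z.im :=
  setIntegral_mono_on (integrableOn_cutEnergy hu hY) (integrableOn_cutEnergy hu (lt_of_lt_of_le hY hYY'))
    ModularGroup.isClosed_fd.measurableSet fun z _ =>
      mul_le_mul_of_nonneg_left (heightCut_mono z.im_pos.le hY hYY')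
        (mul_nonneg (sq_nonneg _) (gradNormSq_nonneg u z))

/-- **The truncated energy identity, real form**: `μ M(Y) = G(Y) + Re X(Y)`. [cite: Iwaniec2002, Lemma 4.1 & (4.3), PDF p. 48] -/
theorem energy_identity_cut_re (hu : IsC2 u) (hua : ∀ γ ∈ (𝒮ℒ : Subgroup (GL (Fin 2) ℝ)), ∀ z : ℍ, u (γ • z) = u z)
    (heig : ∀ z, hypLaplacian u z = -(μ : ℂ) * u z) {Y : ℝ} (hY : 246 ≤ Y) :
    μ * ∫ z in 𝒟, ‖u z‖ ^ 2 * heightCut Y z.im =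
      (∫ z in 𝒟, z.im ^ 2 * gradNormSq u z * heightCut Y z.im) +
        (∫ y in Ioi (0 : ℝ), ((deriv (heightCut Y) y : ℝ) : ℂ) * crossMoment u y).re := by
  have h := energy_identity_cut hu hua heig hY
  rw [integral_complex_ofReal, integral_complex_ofReal] at h
  have h' := congrArg Complex.re h
  simpa using h'

/-- **`λ < 0` is impossible**: an `SL₂(ℤ)`-automorphic `C²` solution of `Δu = -μu` with `μ < 0`
whose mass on horocycles `m(y) = ∫₀¹|u|²` has `m' = 2 Re m₂` and `∫_1^∞ m(y) y⁻² dy < ∞` (i.e. `u`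
square-integrable on the cusp of `𝒟`) vanishes identically ("`-Δ` is non-negative", Lemma 4.1).
[cite: Iwaniec2002, Lemma 4.1 & (4.3), PDF p. 48] -/
theorem eq_zero_of_eigenvalue_neg (hu : IsC2 u) (hua : ∀ γ ∈ (𝒮ℒ : Subgroup (GL (Fin 2) ℝ)), ∀ z : ℍ, u (γ • z) = u z)
    (heig : ∀ z, hypLaplacian u z = -(μ : ℂ) * u z) (hμ : μ < 0)
    (hMd : ∀ y : ℝ, 0 < y → HasDerivAt (hMass u) (2 * (crossMoment u y).re) y)
    (hT : IntegrableOn (fun y => hMass u y * (y ^ 2)⁻¹) (Ioi 1)) : ∀ z, u z = 0 := by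
  obtain ⟨C₂, hC₂0, hC₂⟩ := exists_deriv2_smoothTransition_bound
  have huc : Continuous u := hu.continuous
  set M : ℝ → ℝ := fun Y => ∫ z in 𝒟, ‖u z‖ ^ 2 * heightCut Y z.im with hM
  set τ : ℝ → ℝ := fun Y => ∫ y in Y..(2 * Y), hMass u y * (y ^ 2)⁻¹ with hτ
  have hτ0 : Tendsto τ atTop (𝓝 0) := tendsto_intervalIntegral_tail hT
  have key : ∀ Y, 246 ≤ Y → (-μ) * M Y ≤ 2 * C₂ * τ Y := by
    intro Y hY
    have hY0 : 0 < Y := by linarith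
    have hid := energy_identity_cut_re hu hua heig hY
    have hX := abs_re_integral_crossMoment_le hu hMd hC₂0 hC₂ hY0
    have hG : 0 ≤ ∫ z in 𝒟, z.im ^ 2 * gradNormSq u z * heightCut Y z.im :=
      setIntegral_nonneg ModularGroup.isClosed_fd.measurableSet fun z _ =>
        mul_nonneg (mul_nonneg (sq_nonneg _) (gradNormSq_nonneg u z)) (heightCut_mem_Icc Y z.im).1
    have habs := neg_abs_le
      (∫ y in Ioi (0 : ℝ), ((deriv (heightCut Y) y : ℝ) : ℂ) * crossMoment u y).re
    simp only [hM, hτ]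
    linarith
  have hM0 : ∀ Y, 246 ≤ Y → M Y = 0 := by
    intro Y hY
    have hY0 : 0 < Y := by linarith
    have hMnn : 0 ≤ M Y := setIntegral_nonneg ModularGroup.isClosed_fd.measurableSet fun z _ =>
      mul_nonneg (sq_nonneg _) (heightCut_mem_Icc _ _).1
    refine le_antisymm ?_ hMnn
    have hle : ∀ᶠ Y' in atTop, M Y ≤ 2 * C₂ * τ Y' / (-μ) := by
      filter_upwards [eventually_ge_atTop Y] with Y' hY'
      have h1 : M Y ≤ M Y' := cutMass_mono huc hY0 hY'
      have h2 := key Y' (le_trans hY hY')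
      rw [le_div_iff₀ (by linarith)]
      nlinarith
    have hlim : Tendsto (fun Y' => 2 * C₂ * τ Y' / (-μ)) atTop (𝓝 0) := by
      have := (hτ0.const_mul (2 * C₂)).div_const (-μ)
      simpa using this
    exact ge_of_tendsto hlim hle
  have hfdo : ∀ z ∈ 𝒟ᵒ, u z = 0 := by
    intro z hz
    set Y : ℝ := max 246 z.im with hYdef
    have hY : 246 ≤ Y := le_max_left _ _
    have hY0 : 0 < Y := by linarith
    have hg := eqOn_fdo_zero_of_setIntegral_fd_eq_zero
      (g := fun w : ℍ => ‖u w‖ ^ 2 * heightCut Y w.im)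
      ((huc.norm.pow 2).mul ((contDiff_heightCut Y (n := 0)).continuous.comp
        UpperHalfPlane.continuous_im))
      (fun w => mul_nonneg (sq_nonneg _) (heightCut_mem_Icc _ _).1)
      (integrableOn_cutMass huc hY0) (hM0 Y hY) z hz
    have hζ : heightCut Y z.im = 1 := heightCut_eq_one hY0 (le_max_right _ _)
    simp only [hζ, mul_one, pow_eq_zero_iff two_ne_zero, norm_eq_zero] at hg
    exact hg
  exact eq_const_of_eqOn_fdo huc hua hfdo

/-- **`λ = 0` forces constancy**: an `SL₂(ℤ)`-automorphic `C²` harmonic `u` (`Δu = 0`) which is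
square-integrable on the cusp of `𝒟` (as above) is constant (`∫_F |∇u|² = 0`, Lemma 4.1).
[cite: Iwaniec2002, Lemma 4.1 & (4.3), PDF p. 48; Prop. 6.13 proof ("a harmonic function in `𝔏(Γ\\ℍ)`; hence it is constant"), PDF p. 67] -/
theorem exists_const_of_eigenvalue_zero (hu : IsC2 u) (hua : ∀ γ ∈ (𝒮ℒ : Subgroup (GL (Fin 2) ℝ)), ∀ z : ℍ, u (γ • z) = u z)
    (heig : ∀ z, hypLaplacian u z = -((0 : ℝ) : ℂ) * u z)
    (hMd : ∀ y : ℝ, 0 < y → HasDerivAt (hMass u) (2 * (crossMoment u y).re) y)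
    (hT : IntegrableOn (fun y => hMass u y * (y ^ 2)⁻¹) (Ioi 1)) : ∃ c : ℂ, ∀ z, u z = c := by
  obtain ⟨C₂, hC₂0, hC₂⟩ := exists_deriv2_smoothTransition_bound
  have huc : Continuous u := hu.continuous
  set G : ℝ → ℝ := fun Y => ∫ z in 𝒟, z.im ^ 2 * gradNormSq u z * heightCut Y z.im with hG
  set τ : ℝ → ℝ := fun Y => ∫ y in Y..(2 * Y), hMass u y * (y ^ 2)⁻¹ with hτ
  have hτ0 : Tendsto τ atTop (𝓝 0) := tendsto_intervalIntegral_tail hT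
  have key : ∀ Y, 246 ≤ Y → G Y ≤ 2 * C₂ * τ Y := by
    intro Y hY
    have hY0 : 0 < Y := by linarith
    have hid := energy_identity_cut_re hu hua heig hY
    have hX := abs_re_integral_crossMoment_le hu hMd hC₂0 hC₂ hY0
    have habs := neg_abs_le
      (∫ y in Ioi (0 : ℝ), ((deriv (heightCut Y) y : ℝ) : ℂ) * crossMoment u y).re
    simp only [hG, hτ]
    rw [zero_mul] at hid
    linarith
  have hG0 : ∀ Y, 246 ≤ Y → G Y = 0 := by
    intro Y hY
    have hY0 : 0 < Y := by linarith
    have hGnn : 0 ≤ G Y := setIntegral_nonneg ModularGroup.isClosed_fd.measurableSet fun z _ =>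
      mul_nonneg (mul_nonneg (sq_nonneg _) (gradNormSq_nonneg u z)) (heightCut_mem_Icc Y z.im).1
    refine le_antisymm ?_ hGnn
    have hle : ∀ᶠ Y' in atTop, G Y ≤ 2 * C₂ * τ Y' := by
      filter_upwards [eventually_ge_atTop Y] with Y' hY'
      exact (cutEnergy_mono hu hY0 hY').trans (key Y' (le_trans hY hY'))
    have hlim : Tendsto (fun Y' => 2 * C₂ * τ Y') atTop (𝓝 0) := by
      simpa using hτ0.const_mul (2 * C₂)
    exact ge_of_tendsto hlim hle
  have hfdo : ∀ z ∈ 𝒟ᵒ, gradNormSq u z = 0 := by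
    intro z hz
    set Y : ℝ := max 246 z.im with hYdef
    have hY : 246 ≤ Y := le_max_left _ _
    have hY0 : 0 < Y := by linarith
    have hg := eqOn_fdo_zero_of_setIntegral_fd_eq_zero
      (g := fun w : ℍ => w.im ^ 2 * gradNormSq u w * heightCut Y w.im)
      (((UpperHalfPlane.continuous_im.pow 2).mul (continuous_gradNormSq hu)).mul
        ((contDiff_heightCut Y (n := 0)).continuous.comp UpperHalfPlane.continuous_im))
      (fun w => mul_nonneg (mul_nonneg (sq_nonneg _) (gradNormSq_nonneg u w)) (heightCut_mem_Icc _ _).1)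
      (integrableOn_cutEnergy hu hY0) (hG0 Y hY) z hz
    have hζ : heightCut Y z.im = 1 := heightCut_eq_one hY0 (le_max_right _ _)
    simp only [hζ, mul_one, mul_eq_zero, pow_eq_zero_iff two_ne_zero] at hg
    rcases hg with h | h
    · exact absurd h z.im_ne_zero
    · exact h
  exact exists_const_of_gradNormSq_eq_zero hu hua hfdo

end Main


/-! ### Algebra of `C²` functions: differences, conjugates -/

section Algebra

variable {f g : ℍ → ℂ}

/-- `∇(f - c g) = ∇f - c ∇g` at every point of `ℍ`. [folklore] -/
theorem hypFDeriv_sub_const_mul (hf : IsC2 f) (hg : IsC2 g) (c : ℂ) (z : ℍ) :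
    hypFDeriv (fun w => f w - c * g w) z = hypFDeriv f z - c • hypFDeriv g z := by
  unfold hypFDeriv
  have hU : IsOpen {w : ℂ | 0 < w.im} := isOpen_lt continuous_const Complex.continuous_im
  have hzU : (z : ℂ) ∈ {w : ℂ | 0 < w.im} := z.im_pos
  have hFd : DifferentiableAt ℝ (f ∘ ofComplex) (z : ℂ) :=
    (ContDiffOn.differentiableOn hf (by norm_num)).differentiableAt (hU.mem_nhds hzU)
  have hGd : DifferentiableAt ℝ (g ∘ ofComplex) (z : ℂ) :=
    (ContDiffOn.differentiableOn hg (by norm_num)).differentiableAt (hU.mem_nhds hzU)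
  have e : ((fun w => f w - c * g w) ∘ ofComplex : ℂ → ℂ) =
      (f ∘ ofComplex) - c • (g ∘ ofComplex) := by
    funext w; simp [smul_eq_mul]
  rw [e, fderiv_sub hFd (hGd.const_smul c), fderiv_const_smul hGd]

/-- `∇ f̄ = conj ∇f`. [folklore] -/
theorem hypFDeriv_conj (f : ℍ → ℂ) (z : ℍ) (e : ℂ) :
    hypFDeriv (fun w => conj (f w)) z e = conj (hypFDeriv f z e) := by
  unfold hypFDeriv
  have h : ((fun w => conj (f w)) ∘ ofComplex : ℂ → ℂ) = Complex.conjCLE ∘ (f ∘ ofComplex) := rfl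
  rw [h, Complex.conjCLE.comp_fderiv]
  rfl

/-- The conjugate of an eigenfunction with real eigenvalue is an eigenfunction. [folklore] -/
theorem eigen_conj' {μ : ℝ} (heig : ∀ z, hypLaplacian f z = -(μ : ℂ) * f z) (z : ℍ) :
    hypLaplacian (fun w => conj (f w)) z = -(μ : ℂ) * conj (f z) := by
  rw [hypLaplacian_conj, heig z, map_mul, map_neg, Complex.conj_ofReal]

/-- Eigenfunctions with a common real eigenvalue form a vector space: `f - c g`. [folklore] -/
theorem eigen_sub_const_mul {μ : ℝ} (hf : IsC2 f) (hg : IsC2 g)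
    (hfe : ∀ z, hypLaplacian f z = -(μ : ℂ) * f z) (hge : ∀ z, hypLaplacian g z = -(μ : ℂ) * g z)
    (c : ℂ) (z : ℍ) :
    hypLaplacian (fun w => f w - c * g w) z = -(μ : ℂ) * (f z - c * g z) := by
  rw [hypLaplacian_sub_const_mul hf hg c z, hfe z, hge z]
  ring

/-- Automorphy of `f - c g`. [folklore] -/
theorem automorphic_sub_const_mul (hfa : ∀ γ ∈ (𝒮ℒ : Subgroup (GL (Fin 2) ℝ)), ∀ z : ℍ, f (γ • z) = f z)
    (hga : ∀ γ ∈ (𝒮ℒ : Subgroup (GL (Fin 2) ℝ)), ∀ z : ℍ, g (γ • z) = g z) (c : ℂ) :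
    ∀ γ ∈ (𝒮ℒ : Subgroup (GL (Fin 2) ℝ)), ∀ z : ℍ, (fun w => f w - c * g w) (γ • z) = (fun w => f w - c * g w) z := by
  intro γ hγ z
  simp only [hfa γ hγ z, hga γ hγ z]

/-- Automorphy of `f̄`. [folklore] -/
theorem automorphic_conj (hfa : ∀ γ ∈ (𝒮ℒ : Subgroup (GL (Fin 2) ℝ)), ∀ z : ℍ, f (γ • z) = f z) :
    ∀ γ ∈ (𝒮ℒ : Subgroup (GL (Fin 2) ℝ)), ∀ z : ℍ, (fun w => conj (f w)) (γ • z) = (fun w => conj (f w)) z := by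
  intro γ hγ z
  simp only [hfa γ hγ z]

end Algebra

/-! ### The pair cross moment and the expansion of `m₂(f - c g)` -/

section CrossPair

variable {f g : ℍ → ℂ}

/-- The pair cross moment `C(f, g)(y) = ∫₀¹ ḡ f_y (x + iy) dx` (so that `m₂(u) = C(u, u)`). [folklore] -/
def crossPair (f g : ℍ → ℂ) (y : ℝ) : ℂ :=
  ∫ x in (0 : ℝ)..1, conj (g (pt x y)) * hypFDeriv f (pt x y) Complex.I

/-- `m₂(u) = C(u, u)`. [folklore] -/
theorem crossMoment_eq_crossPair (u : ℍ → ℂ) (y : ℝ) : crossMoment u y = crossPair u u y := rfl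

/-- `C(f, g)` is continuous on `(0, ∞)`. [folklore] -/
theorem continuousOn_crossPair (hf : IsC2 f) (hg : IsC2 g) : ContinuousOn (crossPair f g) (Ioi 0) :=
  continuousOn_intervalIntegral_pt
    ((Complex.continuous_conj.comp hg.continuous).mul (continuous_hypFDeriv_apply hf Complex.I))

/-- Integrability of `ζ' · C(f, g)` against a compactly supported weight in `(0, ∞)`. [folklore] -/
theorem integrableOn_mul_crossPair (hf : IsC2 f) (hg : IsC2 g) {w : ℝ → ℝ} (hw : Continuous w)
    (hws : HasCompactSupport w) (hw0 : tsupport w ⊆ Ioi 0) :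
    IntegrableOn (fun y => ((w y : ℝ) : ℂ) * crossPair f g y) (Ioi 0) := by
  have hK : IsCompact (tsupport w) := hws
  have hcont : ContinuousOn (fun y => ((w y : ℝ) : ℂ) * crossPair f g y) (tsupport w) :=
    ((Complex.continuous_ofReal.comp hw).continuousOn).mul ((continuousOn_crossPair hf hg).mono hw0)
  refine (hcont.integrableOn_compact hK).of_forall_sdiff_eq_zero measurableSet_Ioi fun y hy => ?_
  simp [image_eq_zero_of_notMem_tsupport hy.2]

/-- **Expansion of the cross moment of `f - c g`**:
`m₂(f - c g) = m₂(f) - c̄ C(f, g) - c C(g, f) + |c|² m₂(g)`. [folklore] -/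
theorem crossMoment_sub_const_mul (hf : IsC2 f) (hg : IsC2 g) (c : ℂ) {y : ℝ} (hy : 0 < y) :
    crossMoment (fun w => f w - c * g w) y =
      crossMoment f y - conj c * crossPair f g y - c * crossPair g f y + c * conj c * crossMoment g y := by
  unfold crossMoment crossPair
  have hfc : Continuous fun x : ℝ => f (pt x y) := hf.continuous.comp (continuous_pt hy)
  have hgc : Continuous fun x : ℝ => g (pt x y) := hg.continuous.comp (continuous_pt hy)
  have hfd : Continuous fun x : ℝ => hypFDeriv f (pt x y) Complex.I :=
    (continuous_hypFDeriv_apply hf Complex.I).comp (continuous_pt hy)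
  have hgd : Continuous fun x : ℝ => hypFDeriv g (pt x y) Complex.I :=
    (continuous_hypFDeriv_apply hg Complex.I).comp (continuous_pt hy)
  have hpt : ∀ x : ℝ, conj ((fun w => f w - c * g w) (pt x y)) *
      hypFDeriv (fun w => f w - c * g w) (pt x y) Complex.I =
      conj (f (pt x y)) * hypFDeriv f (pt x y) Complex.I -
        conj c * (conj (g (pt x y)) * hypFDeriv f (pt x y) Complex.I) -
        c * (conj (f (pt x y)) * hypFDeriv g (pt x y) Complex.I) +
        c * conj c * (conj (g (pt x y)) * hypFDeriv g (pt x y) Complex.I) := by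
    intro x
    rw [hypFDeriv_sub_const_mul hf hg c]
    simp only [map_sub, map_mul, FunLike.coe_sub, Pi.sub_apply, FunLike.coe_smul, Pi.smul_apply,
      smul_eq_mul]
    ring
  simp_rw [hpt]
  have i1 : IntervalIntegrable (fun x => conj (f (pt x y)) * hypFDeriv f (pt x y) Complex.I) volume 0 1 :=
    ((Complex.continuous_conj.comp hfc).mul hfd).intervalIntegrable _ _
  have i2 : IntervalIntegrable (fun x => conj c * (conj (g (pt x y)) * hypFDeriv f (pt x y) Complex.I)) volume 0 1 :=
    (((Complex.continuous_conj.comp hgc).mul hfd).const_mul _).intervalIntegrable _ _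
  have i3 : IntervalIntegrable (fun x => c * (conj (f (pt x y)) * hypFDeriv g (pt x y) Complex.I)) volume 0 1 :=
    (((Complex.continuous_conj.comp hfc).mul hgd).const_mul _).intervalIntegrable _ _
  have i4 : IntervalIntegrable (fun x => c * conj c * (conj (g (pt x y)) * hypFDeriv g (pt x y) Complex.I)) volume 0 1 :=
    (((Complex.continuous_conj.comp hgc).mul hgd).const_mul _).intervalIntegrable _ _
  rw [intervalIntegral.integral_add ((i1.sub i2).sub i3) i4, intervalIntegral.integral_sub (i1.sub i2) i3,
    intervalIntegral.integral_sub i1 i2, intervalIntegral.integral_const_mul,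
    intervalIntegral.integral_const_mul, intervalIntegral.integral_const_mul]

end CrossPair

/-! ### The cross term of the truncated energy identity is real; polarization -/

section Polarization

variable {f g : ℍ → ℂ} {μ : ℝ}

/-- The truncated cross term `X_Y(u) = ∫ ζ_Y' m₂(u)`. [folklore] -/
def cutCross (Y : ℝ) (u : ℍ → ℂ) : ℂ :=
  ∫ y in Ioi (0 : ℝ), ((deriv (heightCut Y) y : ℝ) : ℂ) * crossMoment u y

/-- The truncated pair cross term `∫ ζ_Y' C(f, g)`. [folklore] -/
def cutCrossPair (Y : ℝ) (f g : ℍ → ℂ) : ℂ :=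
  ∫ y in Ioi (0 : ℝ), ((deriv (heightCut Y) y : ℝ) : ℂ) * crossPair f g y

/-- **The cross term is real** for an automorphic eigenfunction: `X_Y(u) = μ M_Y(u) - G_Y(u) ∈ ℝ`
(imaginary part of the truncated energy identity). [cite: Iwaniec2002, Lemma 4.1, PDF p. 48] -/
theorem im_cutCross_eq_zero {u : ℍ → ℂ} (hu : IsC2 u) (hua : ∀ γ ∈ (𝒮ℒ : Subgroup (GL (Fin 2) ℝ)), ∀ z : ℍ, u (γ • z) = u z)
    (heig : ∀ z, hypLaplacian u z = -(μ : ℂ) * u z) {Y : ℝ} (hY : 246 ≤ Y) :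
    (cutCross Y u).im = 0 := by
  have h := energy_identity_cut hu hua heig hY
  rw [integral_complex_ofReal, integral_complex_ofReal] at h
  have h' := congrArg Complex.im h
  simp only [Complex.mul_im, Complex.ofReal_re, Complex.ofReal_im, mul_zero, zero_mul, add_zero,
    Complex.add_im, zero_add] at h'
  unfold cutCross
  linarith

/-- `ζ_Y'` data: continuity, compact support in `(0, ∞)`. [folklore] -/
theorem deriv_heightCut_data {Y : ℝ} (hY : 0 < Y) :
    Continuous (deriv (heightCut Y)) ∧ HasCompactSupport (deriv (heightCut Y)) ∧
      tsupport (deriv (heightCut Y)) ⊆ Ioi 0 :=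
  ⟨continuous_deriv_heightCut Y, hasCompactSupport_deriv_heightCut hY,
    (tsupport_deriv_heightCut hY).trans fun _ hy => lt_of_lt_of_le hY hy.1⟩

/-- Expansion of `X_Y(f - c g)`. [folklore] -/
theorem cutCross_sub_const_mul (hf : IsC2 f) (hg : IsC2 g) (c : ℂ) {Y : ℝ} (hY : 0 < Y) :
    cutCross Y (fun w => f w - c * g w) =
      cutCross Y f - conj c * cutCrossPair Y f g - c * cutCrossPair Y g f + c * conj c * cutCross Y g := by
  obtain ⟨hζc, hζs, hζ0⟩ := deriv_heightCut_data hY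
  unfold cutCross cutCrossPair
  have hpt : ∀ y ∈ Ioi (0 : ℝ), ((deriv (heightCut Y) y : ℝ) : ℂ) * crossMoment (fun w => f w - c * g w) y =
      ((deriv (heightCut Y) y : ℝ) : ℂ) * crossMoment f y -
        conj c * (((deriv (heightCut Y) y : ℝ) : ℂ) * crossPair f g y) -
        c * (((deriv (heightCut Y) y : ℝ) : ℂ) * crossPair g f y) +
        c * conj c * (((deriv (heightCut Y) y : ℝ) : ℂ) * crossMoment g y) := by
    intro y hy
    rw [crossMoment_sub_const_mul hf hg c hy]
    ring
  rw [setIntegral_congr_fun measurableSet_Ioi hpt]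
  have i1 : IntegrableOn (fun y => ((deriv (heightCut Y) y : ℝ) : ℂ) * crossMoment f y) (Ioi 0) :=
    integrableOn_mul_crossMoment hf hζc hζs hζ0
  have i2 : IntegrableOn (fun y => conj c * (((deriv (heightCut Y) y : ℝ) : ℂ) * crossPair f g y)) (Ioi 0) :=
    (integrableOn_mul_crossPair hf hg hζc hζs hζ0).const_mul _
  have i3 : IntegrableOn (fun y => c * (((deriv (heightCut Y) y : ℝ) : ℂ) * crossPair g f y)) (Ioi 0) :=
    (integrableOn_mul_crossPair hg hf hζc hζs hζ0).const_mul _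
  have i4 : IntegrableOn (fun y => c * conj c * (((deriv (heightCut Y) y : ℝ) : ℂ) * crossMoment g y)) (Ioi 0) :=
    (integrableOn_mul_crossMoment hg hζc hζs hζ0).const_mul _
  have i12 : Integrable (fun y => ((deriv (heightCut Y) y : ℝ) : ℂ) * crossMoment f y -
      conj c * (((deriv (heightCut Y) y : ℝ) : ℂ) * crossPair f g y)) (volume.restrict (Ioi 0)) :=
    i1.sub i2
  have i123 : Integrable (fun y => ((deriv (heightCut Y) y : ℝ) : ℂ) * crossMoment f y -
      conj c * (((deriv (heightCut Y) y : ℝ) : ℂ) * crossPair f g y) -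
      c * (((deriv (heightCut Y) y : ℝ) : ℂ) * crossPair g f y)) (volume.restrict (Ioi 0)) :=
    i12.sub i3
  rw [integral_add i123 i4, integral_sub i12 i3, integral_sub i1 i2,
    MeasureTheory.integral_const_mul, MeasureTheory.integral_const_mul,
    MeasureTheory.integral_const_mul]

/-- **Polarization**: for two automorphic `C²` eigenfunctions `f, g` of `Δ` with the same real
eigenvalue, `∫ ζ_Y' C(g, f) = conj ∫ ζ_Y' C(f, g)` — the antisymmetric part of Lemma 4.1 with
cut-off, from the reality of `X_Y(f + g)` and `X_Y(f + i g)`. [cite: Iwaniec2002, Lemma 4.1, PDF p. 48] -/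
theorem cutCrossPair_swap (hf : IsC2 f) (hg : IsC2 g)
    (hfa : ∀ γ ∈ (𝒮ℒ : Subgroup (GL (Fin 2) ℝ)), ∀ z : ℍ, f (γ • z) = f z) (hga : ∀ γ ∈ (𝒮ℒ : Subgroup (GL (Fin 2) ℝ)), ∀ z : ℍ, g (γ • z) = g z)
    (hfe : ∀ z, hypLaplacian f z = -(μ : ℂ) * f z) (hge : ∀ z, hypLaplacian g z = -(μ : ℂ) * g z)
    {Y : ℝ} (hY : 246 ≤ Y) :
    cutCrossPair Y g f = conj (cutCrossPair Y f g) := by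
  have hY0 : 0 < Y := by linarith
  have hXf := im_cutCross_eq_zero hf hfa hfe hY
  have hXg := im_cutCross_eq_zero hg hga hge hY
  -- `u₁ = f + g = f - (-1) g`
  have h1 := im_cutCross_eq_zero ((hf.sub_const_mul hg (-1)))
    (automorphic_sub_const_mul hfa hga (-1)) (eigen_sub_const_mul hf hg hfe hge (-1)) hY
  rw [cutCross_sub_const_mul hf hg (-1) hY0] at h1
  -- `u₂ = f + i g = f - (-i) g`
  have h2 := im_cutCross_eq_zero ((hf.sub_const_mul hg (-Complex.I)))
    (automorphic_sub_const_mul hfa hga (-Complex.I)) (eigen_sub_const_mul hf hg hfe hge (-Complex.I)) hY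
  rw [cutCross_sub_const_mul hf hg (-Complex.I) hY0] at h2
  set A := cutCrossPair Y f g with hA
  set B := cutCrossPair Y g f with hB
  simp only [map_neg, map_one, Complex.conj_I, neg_neg, Complex.sub_im, Complex.add_im,
    Complex.mul_im, Complex.neg_re, Complex.neg_im, Complex.one_re, Complex.one_im,
    Complex.I_re, Complex.I_im, Complex.mul_re] at h1 h2
  norm_num at h1 h2
  apply Complex.ext
  · simp only [Complex.conj_re]
    linarith [h1, h2, hXf, hXg]
  · simp only [Complex.conj_im]
    linarith [h1, h2, hXf, hXg]

/-- The Wronskian moment `W(g, h)(y) = ∫₀¹ (g h_y - h g_y)(x + iy) dx` of two functions on a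
horocycle (the boundary term of Green's formula in the proof of Theorem 6.14).
[cite: Iwaniec2002, Thm 6.14 proof, PDF pp. 67–68] -/
def wronskianMoment (g h : ℍ → ℂ) (y : ℝ) : ℂ :=
  ∫ x in (0 : ℝ)..1,
    (g (pt x y) * hypFDeriv h (pt x y) Complex.I - h (pt x y) * hypFDeriv g (pt x y) Complex.I)

/-- Conjugation commutes with interval integrals. [folklore] -/
theorem intervalIntegral_conj' (F : ℝ → ℂ) (a b : ℝ) :
    ∫ x in a..b, conj (F x) = conj (∫ x in a..b, F x) := by
  simp only [intervalIntegral, integral_conj, map_sub]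

variable {h : ℍ → ℂ}

/-- `W(g, h) = C(h, ḡ) - C(g, h̄)` in terms of pair cross moments. [folklore] -/
theorem wronskianMoment_eq (hg : IsC2 g) (hh : IsC2 h) {y : ℝ} (hy : 0 < y) :
    wronskianMoment g h y =
      crossPair h (fun w => conj (g w)) y - crossPair g (fun w => conj (h w)) y := by
  unfold wronskianMoment crossPair
  simp only [Complex.conj_conj]
  have hgc : Continuous fun x : ℝ => g (pt x y) := hg.continuous.comp (continuous_pt hy)
  have hhc : Continuous fun x : ℝ => h (pt x y) := hh.continuous.comp (continuous_pt hy)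
  have hgd : Continuous fun x : ℝ => hypFDeriv g (pt x y) Complex.I :=
    (continuous_hypFDeriv_apply hg Complex.I).comp (continuous_pt hy)
  have hhd : Continuous fun x : ℝ => hypFDeriv h (pt x y) Complex.I :=
    (continuous_hypFDeriv_apply hh Complex.I).comp (continuous_pt hy)
  have i1 : IntervalIntegrable (fun x => g (pt x y) * hypFDeriv h (pt x y) Complex.I) volume 0 1 :=
    (hgc.mul hhd).intervalIntegrable _ _
  have i2 : IntervalIntegrable (fun x => h (pt x y) * hypFDeriv g (pt x y) Complex.I) volume 0 1 :=
    (hhc.mul hgd).intervalIntegrable _ _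
  exact intervalIntegral.integral_sub i1 i2

/-- `C(ḡ, h) = conj C(g, h̄)`. [folklore] -/
theorem crossPair_conj_conj (g h : ℍ → ℂ) (y : ℝ) :
    crossPair (fun w => conj (g w)) h y = conj (crossPair g (fun w => conj (h w)) y) := by
  unfold crossPair
  rw [← intervalIntegral_conj']
  refine intervalIntegral.integral_congr fun x _ => ?_
  simp only [hypFDeriv_conj, map_mul, Complex.conj_conj]

/-- `∫ ζ' C(ḡ, h) = conj ∫ ζ' C(g, h̄)`. [folklore] -/
theorem cutCrossPair_conj_conj (Y : ℝ) (g h : ℍ → ℂ) :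
    cutCrossPair Y (fun w => conj (g w)) h = conj (cutCrossPair Y g (fun w => conj (h w))) := by
  unfold cutCrossPair
  rw [← integral_conj]
  refine setIntegral_congr_fun measurableSet_Ioi fun y _ => ?_
  rw [crossPair_conj_conj, map_mul, Complex.conj_ofReal]

/-- **The truncated Maass–Selberg relation for equal eigenvalues** (Green's formula on the
truncated fundamental domain, the side terms cancelling by automorphy; here: the antisymmetric part
of Lemma 4.1 with the smooth cut-off `ζ_Y`): for two `SL₂(ℤ)`-automorphic `C²` eigenfunctions
`g, h` of `Δ` with the same real eigenvalue, `∫ ζ_Y'(y) W(g, h)(y) dy = 0` for `Y ≥ 246`.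
[cite: Iwaniec2002, Thm 6.14 & (6.34) (λ₁ = λ₂), PDF pp. 67–68; Lemma 4.1, PDF p. 48] -/
theorem integral_deriv_heightCut_mul_wronskianMoment (hg : IsC2 g) (hh : IsC2 h)
    (hga : ∀ γ ∈ (𝒮ℒ : Subgroup (GL (Fin 2) ℝ)), ∀ z : ℍ, g (γ • z) = g z) (hha : ∀ γ ∈ (𝒮ℒ : Subgroup (GL (Fin 2) ℝ)), ∀ z : ℍ, h (γ • z) = h z)
    (hge : ∀ z, hypLaplacian g z = -(μ : ℂ) * g z) (hhe : ∀ z, hypLaplacian h z = -(μ : ℂ) * h z)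
    {Y : ℝ} (hY : 246 ≤ Y) :
    ∫ y in Ioi (0 : ℝ), ((deriv (heightCut Y) y : ℝ) : ℂ) * wronskianMoment g h y = 0 := by
  have hY0 : 0 < Y := by linarith
  obtain ⟨hζc, hζs, hζ0⟩ := deriv_heightCut_data hY0
  set G : ℍ → ℂ := fun w => conj (g w) with hGdef
  set H : ℍ → ℂ := fun w => conj (h w) with hHdef
  have hG2 : IsC2 G := hg.conj
  have hH2 : IsC2 H := hh.conj
  -- the swap identity for the admissible pair `(h, G)`
  have hswap : cutCrossPair Y G h = conj (cutCrossPair Y h G) :=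
    cutCrossPair_swap hh hG2 hha (automorphic_conj hga) hhe (eigen_conj' hge) hY
  -- `cutCrossPair Y G h = conj (cutCrossPair Y g H)`
  have hcc : cutCrossPair Y G h = conj (cutCrossPair Y g H) := cutCrossPair_conj_conj Y g h
  have hkey : cutCrossPair Y g H = cutCrossPair Y h G := by
    have := hcc.symm.trans hswap
    exact (starRingEnd ℂ).injective this
  -- assemble
  have hW : ∀ y ∈ Ioi (0 : ℝ), ((deriv (heightCut Y) y : ℝ) : ℂ) * wronskianMoment g h y =
      ((deriv (heightCut Y) y : ℝ) : ℂ) * crossPair h G y -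
        ((deriv (heightCut Y) y : ℝ) : ℂ) * crossPair g H y := by
    intro y hy
    rw [wronskianMoment_eq hg hh hy]
    ring
  rw [setIntegral_congr_fun measurableSet_Ioi hW,
    integral_sub (integrableOn_mul_crossPair hh hG2 hζc hζs hζ0)
      (integrableOn_mul_crossPair hg hH2 hζc hζs hζ0)]
  change cutCrossPair Y h G - cutCrossPair Y g H = 0
  rw [hkey, sub_self]

end Polarization

end Literature.NumberTheory.Automorphic

end
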